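import Mathlib.Data.Real.Basic
import Mathlib.Algebra.Order.Field.Basic
import Mathlib.Algebra.BigOperators.Ring.Finset
import Mathlib.Algebra.Order.BigOperators.Group.Finset
import Mathlib.Tactic.Linarith
import Mathlib.Tactic.Positivity
import Mathlib.Tactic.Ring
import Mathlib.Tactic.FieldSimp
import HarnessLib

/-!
# `NoHeavyLowerTail` (stmt-CriticalPhenomena-4575) — the CORE CERTIFICATE for unavoidable big-piece variance

Support file (prover prim-ineq-gen-8 gen 47; `--supports stmt-CriticalPhenomena-4575`; memo
run/shared/lean/prim/prim-ineq-gen-8/FINDING-gen47-POTENTIAL.md §6).  Pure finite-sum real algebra: no definitions, no named facts, no sorries.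

SETTING.  Along any decision tree for the apex cluster `K`, a state `t` has weight `ν_t ≥ 0`, expected piece load `a_t`, piece second
moment `b_t`, and — for a fixed vertex (or internally wired core) `z` of load `ℓ` — the probability `φ_t = P(z ∈ piece_t)`; always
`a_t ≥ ℓ φ_t` and `b_t ≥ ℓ² φ_t`; `t` is SMALL at level `m` iff `b_t ≤ m a_t`.  The Doob calculus gives `Σ_t ν_t φ_t² = Var(1[z ∈ K])` and
`Σ_t ν_t φ_t a_t = Cov(1[z ∈ K], L)`, and `X_big = Σ_{t big} ν_t a_t²` is the big-piece variance of the tree.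

THIS FILE proves [this work] the finite-sum inequality behind the certificate
  **`X_big ≥ (ℓ/(ℓ − m)) · (ℓ² Σ_t ν_t φ_t² − m Σ_t ν_t φ_t a_t)`  for `ℓ > m ≥ 0`**
(`core_certificate`), i.e. `X_big(T) ≥ (ℓ_z/(ℓ_z − m)) (ℓ_z² Var I_z − m Cov(I_z, L))⁺` for every heavy vertex `z` and every tree `T`
— the lower bound `β′` that, fed into the potential `min(mF, V − β′)` of `…APLVwPotential.lean`, closes the layer-cake induction step (L_β′)
in every tested instance (memo §6).  Ingredients, all termwise: on small states `φ_t ≤ b_t/ℓ² ≤ m a_t/ℓ²`; on big states `a_t ≥ ℓ φ_t`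
and `a_t² ≥ ℓ² φ_t²`.
-/

noncomputable section

namespace Summit.CriticalPhenomena.PercolationContinuityZ3.Theorems

namespace APL

open Finset
open scoped BigOperators

/-- **Core certificate (finite-sum form).**  Let `ν, φ ≥ 0`, `a ≥ ℓ φ`, `b ≥ ℓ² φ` termwise on a finite set `s`, `0 ≤ m < ℓ`.  Then the
`ν a²`-mass of the BIG indices (`m a_t < b_t`) is at least `(ℓ/(ℓ−m)) (ℓ² Σ ν φ² − m Σ ν φ a)`.  (Read: the big-piece variance of any
decision tree is at least `(ℓ_z/(ℓ_z−m)) (ℓ_z² Var I_z − m Cov(I_z, L))` for every vertex `z` heavier than `m`.) [this work] -/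
theorem core_certificate {ι : Type*} (s : Finset ι) (ν a b φ : ι → ℝ) (ℓ m : ℝ) (hm : 0 ≤ m) (hℓ : m < ℓ)
    (hν : ∀ t ∈ s, 0 ≤ ν t) (hφ : ∀ t ∈ s, 0 ≤ φ t) (ha : ∀ t ∈ s, ℓ * φ t ≤ a t) (hb : ∀ t ∈ s, ℓ ^ 2 * φ t ≤ b t) :
    ℓ / (ℓ - m) * (ℓ ^ 2 * ∑ t ∈ s, ν t * φ t ^ 2 - m * ∑ t ∈ s, ν t * φ t * a t)
      ≤ ∑ t ∈ s.filter (fun t => m * a t < b t), ν t * a t ^ 2 := by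
  classical
  have hℓ0 : 0 < ℓ := lt_of_le_of_lt hm hℓ
  have hℓm : 0 < ℓ - m := by linarith
  set Big := s.filter (fun t => m * a t < b t) with hBig
  set Sm := s.filter (fun t => ¬ (m * a t < b t)) with hSm
  -- split the two full sums
  have split_φ2 : ∑ t ∈ s, ν t * φ t ^ 2 = ∑ t ∈ Big, ν t * φ t ^ 2 + ∑ t ∈ Sm, ν t * φ t ^ 2 := by
    rw [hBig, hSm, Finset.sum_filter_add_sum_filter_not]
  have split_φa : ∑ t ∈ s, ν t * φ t * a t = ∑ t ∈ Big, ν t * φ t * a t + ∑ t ∈ Sm, ν t * φ t * a t := by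
    rw [hBig, hSm, Finset.sum_filter_add_sum_filter_not]
  -- (1) small states: ν φ² ≤ (m/ℓ²) ν φ a
  have h1 : ∑ t ∈ Sm, ν t * φ t ^ 2 ≤ m / ℓ ^ 2 * ∑ t ∈ Sm, ν t * φ t * a t := by
    rw [Finset.mul_sum]
    refine Finset.sum_le_sum fun t ht => ?_
    have hts : t ∈ s := (Finset.mem_filter.mp ht).1
    have hsmall : b t ≤ m * a t := not_lt.mp (Finset.mem_filter.mp ht).2
    have hφt := hφ t hts; have hνt := hν t hts
    -- φ ≤ b/ℓ² ≤ m a/ℓ²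
    have hφle : φ t ≤ m * a t / ℓ ^ 2 := by
      rw [le_div_iff₀ (by positivity)]
      calc φ t * ℓ ^ 2 = ℓ ^ 2 * φ t := by ring
        _ ≤ b t := hb t hts
        _ ≤ m * a t := hsmall
    have : ν t * φ t * φ t ≤ ν t * φ t * (m * a t / ℓ ^ 2) :=
      mul_le_mul_of_nonneg_left hφle (mul_nonneg hνt hφt)
    calc ν t * φ t ^ 2 = ν t * φ t * φ t := by ring
      _ ≤ ν t * φ t * (m * a t / ℓ ^ 2) := this
      _ = m / ℓ ^ 2 * (ν t * φ t * a t) := by field_simp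
  -- (2) big states: ν φ a ≥ ℓ ν φ²  and  ν a² ≥ ℓ² ν φ²
  have h2 : ℓ * ∑ t ∈ Big, ν t * φ t ^ 2 ≤ ∑ t ∈ Big, ν t * φ t * a t := by
    rw [Finset.mul_sum]
    refine Finset.sum_le_sum fun t ht => ?_
    have hts : t ∈ s := (Finset.mem_filter.mp ht).1
    have hφt := hφ t hts; have hνt := hν t hts
    have : ν t * φ t * (ℓ * φ t) ≤ ν t * φ t * a t := mul_le_mul_of_nonneg_left (ha t hts) (mul_nonneg hνt hφt)
    calc ℓ * (ν t * φ t ^ 2) = ν t * φ t * (ℓ * φ t) := by ring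
      _ ≤ ν t * φ t * a t := this
  have h3 : ℓ ^ 2 * ∑ t ∈ Big, ν t * φ t ^ 2 ≤ ∑ t ∈ Big, ν t * a t ^ 2 := by
    rw [Finset.mul_sum]
    refine Finset.sum_le_sum fun t ht => ?_
    have hts : t ∈ s := (Finset.mem_filter.mp ht).1
    have hφt := hφ t hts; have hνt := hν t hts
    have hℓφ : 0 ≤ ℓ * φ t := mul_nonneg hℓ0.le hφt
    have hat : 0 ≤ a t := le_trans hℓφ (ha t hts)
    have hsq : (ℓ * φ t) ^ 2 ≤ a t ^ 2 := by
      have := ha t hts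
      nlinarith
    calc ℓ ^ 2 * (ν t * φ t ^ 2) = ν t * (ℓ * φ t) ^ 2 := by ring
      _ ≤ ν t * a t ^ 2 := mul_le_mul_of_nonneg_left hsq hνt
  -- combine: with u = Σ_Big ν φ², P = Σ ν φ², C = Σ ν φ a:  P − u ≤ (m/ℓ²)(C − ℓ u)
  set u := ∑ t ∈ Big, ν t * φ t ^ 2 with hu
  set P := ∑ t ∈ s, ν t * φ t ^ 2 with hP
  set C := ∑ t ∈ s, ν t * φ t * a t with hC
  have hsm_φa : ∑ t ∈ Sm, ν t * φ t * a t = C - ∑ t ∈ Big, ν t * φ t * a t := by linarith [split_φa]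
  have key : P - u ≤ m / ℓ ^ 2 * (C - ℓ * u) := by
    have hmon : m / ℓ ^ 2 * ∑ t ∈ Sm, ν t * φ t * a t ≤ m / ℓ ^ 2 * (C - ℓ * u) := by
      apply mul_le_mul_of_nonneg_left _ (by positivity)
      rw [hsm_φa]; linarith [h2]
    linarith [split_φ2, h1, hmon]
  -- hence (ℓ − m) u ≥ ℓ P − (m/ℓ) C, i.e. ℓ² u ≥ (ℓ/(ℓ−m)) (ℓ² P − m C)
  have key2 : ℓ / (ℓ - m) * (ℓ ^ 2 * P - m * C) ≤ ℓ ^ 2 * u := by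
    rw [div_mul_eq_mul_div, div_le_iff₀ hℓm]
    -- goal: ℓ (ℓ² P − m C) ≤ ℓ² u (ℓ − m)
    have hℓ2 : 0 < ℓ ^ 2 := by positivity
    have k3 : ℓ ^ 2 * (P - u) ≤ m * (C - ℓ * u) := by
      have := mul_le_mul_of_nonneg_left key hℓ2.le
      have e : ℓ ^ 2 * (m / ℓ ^ 2 * (C - ℓ * u)) = m * (C - ℓ * u) := by field_simp
      linarith [this, e]
    nlinarith [k3]
  linarith [key2, h3]

/-- **Core certificate, positive-part form**: since the big mass is nonnegative, the bound holds with `(·)⁺`. [this work] -/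
theorem core_certificate_pos {ι : Type*} (s : Finset ι) (ν a b φ : ι → ℝ) (ℓ m : ℝ) (hm : 0 ≤ m) (hℓ : m < ℓ)
    (hν : ∀ t ∈ s, 0 ≤ ν t) (hφ : ∀ t ∈ s, 0 ≤ φ t) (ha : ∀ t ∈ s, ℓ * φ t ≤ a t) (hb : ∀ t ∈ s, ℓ ^ 2 * φ t ≤ b t) :
    max (ℓ / (ℓ - m) * (ℓ ^ 2 * ∑ t ∈ s, ν t * φ t ^ 2 - m * ∑ t ∈ s, ν t * φ t * a t)) 0
      ≤ ∑ t ∈ s.filter (fun t => m * a t < b t), ν t * a t ^ 2 := by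
  refine max_le (core_certificate s ν a b φ ℓ m hm hℓ hν hφ ha hb) ?_
  refine Finset.sum_nonneg fun t ht => ?_
  have hts : t ∈ s := (Finset.mem_filter.mp ht).1
  exact mul_nonneg (hν t hts) (sq_nonneg _)

/-- **Additivity over disjoint cores.**  If `a_t ≥ Σ_j ℓ_j φ^{(j)}_t` with all terms nonnegative (pieces containing pairwise disjoint
cores contribute disjoint loads), then `a_t² ≥ Σ_j ℓ_j² (φ^{(j)}_t)²`; this is the termwise fact that lets the certificates of disjoint cores be
SUMMED.  Stated for a finite family. [this work] -/
theorem sq_sum_ge_sum_sq {κ : Type*} (J : Finset κ) (x : κ → ℝ) (a : ℝ) (hx : ∀ j ∈ J, 0 ≤ x j) (ha : ∑ j ∈ J, x j ≤ a) :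
    ∑ j ∈ J, x j ^ 2 ≤ a ^ 2 := by
  have hS : 0 ≤ ∑ j ∈ J, x j := Finset.sum_nonneg hx
  have h1 : ∑ j ∈ J, x j ^ 2 ≤ (∑ j ∈ J, x j) ^ 2 := by
    rw [sq, Finset.sum_mul_sum, ← Finset.sum_attach] 
    rw [← Finset.sum_attach (s := J) (f := fun i => ∑ j ∈ J, x i * x j)]
    refine Finset.sum_le_sum fun i _ => ?_
    have hi : 0 ≤ x i := hx i i.2
    calc x i ^ 2 = x i * x i := sq _
      _ ≤ ∑ j ∈ J, x i * x j := by
          rw [← Finset.sum_attach]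
          have : x (i : κ) * x i = ∑ j ∈ ({i} : Finset {j // j ∈ J}), x (i:κ) * x (j:κ) := by simp
          rw [this]
          refine Finset.sum_le_sum_of_subset_of_nonneg (by simp) fun j _ _ => mul_nonneg hi (hx j j.2)
  calc ∑ j ∈ J, x j ^ 2 ≤ (∑ j ∈ J, x j) ^ 2 := h1
    _ ≤ a ^ 2 := by nlinarith [hS, ha]

end APL

end Summit.CriticalPhenomena.PercolationContinuityZ3.Theorems

end
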